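import Literature.MathematicalPhysics.QuantumLattice.HubbardFermiRadiusBandContinuous
import HarnessLib

/-!
# The band Fermi radius is smooth, jointly in the level and the angle

Topic `Literature/MathematicalPhysics/QuantumLattice`; continues `HubbardFermiRadiusBand.lean`
(the polar radius `u_μ(θ) = bandFermiRadius μ θ` of the Fermi curve `{ε = μ}` of
`ε(k) = -2(cos k₁ + cos k₂)`, `-4 < μ < 0`) exactly as `HubbardFermiRadiusSmooth.lean` continues
`HubbardFermiRadius.lean`, with the level `μ` now a variable of the implicit function theorem:
the equation `G((μ, θ), t) = F(θ, t) - μ = 0`, `F = rayDispersion`, has `∂_t G = ∂_t F > 0` at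
every Fermi point (`rayDispersionDt_bandFermiRadius_pos`), so

* `contDiffAt_bandFermiRadius_uncurry`, `contDiffOn_bandFermiRadius_uncurry` —
  **`(μ, θ) ↦ u_μ(θ)` is `C^n` (every `n ≤ ω`) on `(-4, 0) × ℝ`**; `contDiff_bandFermiRadius` — in
  the angle at fixed level;
* `hasDerivAt_bandFermiRadius` — `∂_θ u = bandFermiRadiusDeriv = -∂_θF/∂_tF`;
  `hasDerivAt_bandFermiRadius_level` — `∂_μ u = 1/∂_tF`;
* `continuousOn_bandFermiRadius_angleDeriv` — the angular derivative is jointly continuous in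
  `(μ, θ)`; `continuous_bandFermiRadiusDeriv`.

Everything is proved; no new definitions. [folklore]

## Sources

Folklore; the polar description of the Fermi curve is Benfatto–Giuliani–Mastropietro,
Ann. Henri Poincaré 7 (2006), §1 (1.4)–(1.5) (`BenfattoGiulianiMastropietro2006`).
-/

noncomputable section

open Real Set Filter
open scoped Topology ContDiff

namespace Literature.MathematicalPhysics.QuantumLattice

open scoped ContDiff

/-! ### The level function with the level as a variable -/

/-- The parametrised level function `G((μ, θ), t) = F(θ, t) - μ` is real-analytic. [folklore] -/
theorem contDiff_bandLevelFun {n : WithTop ℕ∞} :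
    ContDiff ℝ n (fun x : (ℝ × ℝ) × ℝ => rayDispersion (x.1.2, x.2) - x.1.1) :=
  (contDiff_rayDispersion.comp ((contDiff_snd.comp contDiff_fst).prodMk contDiff_snd)).sub
    (contDiff_fst.comp contDiff_fst)

/-- The Fréchet derivative of `G`: `DG((μ,θ),t)((a,b),c) = b ∂_θF + c ∂_tF - a`. [folklore] -/
theorem fderiv_bandLevelFun_apply (μ θ t a b c : ℝ) :
    fderiv ℝ (fun x : (ℝ × ℝ) × ℝ => rayDispersion (x.1.2, x.2) - x.1.1) ((μ, θ), t) ((a, b), c) =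
      b * rayDispersionDθ θ t + c * rayDispersionDt θ t - a := by
  -- the inner affine maps
  set L : (ℝ × ℝ) × ℝ →L[ℝ] ℝ × ℝ :=
    ((ContinuousLinearMap.snd ℝ ℝ ℝ).comp (ContinuousLinearMap.fst ℝ (ℝ × ℝ) ℝ)).prod
      (ContinuousLinearMap.snd ℝ (ℝ × ℝ) ℝ) with hL
  set P : (ℝ × ℝ) × ℝ →L[ℝ] ℝ :=
    (ContinuousLinearMap.fst ℝ ℝ ℝ).comp (ContinuousLinearMap.fst ℝ (ℝ × ℝ) ℝ) with hP
  have hLf : HasFDerivAt (fun x : (ℝ × ℝ) × ℝ => ((x.1.2, x.2) : ℝ × ℝ)) L ((μ, θ), t) :=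
    L.hasFDerivAt
  have hPf : HasFDerivAt (fun x : (ℝ × ℝ) × ℝ => x.1.1) P ((μ, θ), t) := P.hasFDerivAt
  have hF : HasFDerivAt rayDispersion (fderiv ℝ rayDispersion (θ, t)) (θ, t) :=
    ((contDiff_rayDispersion (n := 1)).differentiable one_ne_zero (θ, t)).hasFDerivAt
  have hcomp : HasFDerivAt (fun x : (ℝ × ℝ) × ℝ => rayDispersion (x.1.2, x.2))
      ((fderiv ℝ rayDispersion (θ, t)).comp L) ((μ, θ), t) :=
    HasFDerivAt.comp (((μ, θ), t) : (ℝ × ℝ) × ℝ) (g := rayDispersion)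
      (f := fun x : (ℝ × ℝ) × ℝ => ((x.1.2, x.2) : ℝ × ℝ)) hF hLf
  have hG : HasFDerivAt (fun x : (ℝ × ℝ) × ℝ => rayDispersion (x.1.2, x.2) - x.1.1)
      ((fderiv ℝ rayDispersion (θ, t)).comp L - P) ((μ, θ), t) := hcomp.sub hPf
  rw [hG.fderiv]
  simp [hL, hP, fderiv_rayDispersion_apply]

/-- The `t`-partial of `G` is multiplication by `∂_t F`. [folklore] -/
theorem fderiv_bandLevelFun_comp_inr_apply (μ θ t c : ℝ) :
    (fderiv ℝ (fun x : (ℝ × ℝ) × ℝ => rayDispersion (x.1.2, x.2) - x.1.1) ((μ, θ), t) ∘L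
      ContinuousLinearMap.inr ℝ (ℝ × ℝ) ℝ) c = c * rayDispersionDt θ t := by
  rw [ContinuousLinearMap.comp_apply, ContinuousLinearMap.inr_apply]
  have h := fderiv_bandLevelFun_apply μ θ t 0 0 c
  simp only [Prod.mk_zero_zero] at h ⊢
  rw [h]; ring

/-- Where `∂_t F ≠ 0` the `t`-partial of `G` is invertible. [folklore] -/
theorem isInvertible_fderiv_bandLevelFun_comp_inr {μ θ t : ℝ} (h : rayDispersionDt θ t ≠ 0) :
    (fderiv ℝ (fun x : (ℝ × ℝ) × ℝ => rayDispersion (x.1.2, x.2) - x.1.1) ((μ, θ), t) ∘L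
      ContinuousLinearMap.inr ℝ (ℝ × ℝ) ℝ).IsInvertible := by
  refine ⟨ContinuousLinearEquiv.unitsEquivAut ℝ (Units.mk0 _ h), ContinuousLinearMap.ext_ring ?_⟩
  rw [ContinuousLinearEquiv.coe_coe, ContinuousLinearEquiv.unitsEquivAut_apply, Units.val_mk0,
    fderiv_bandLevelFun_comp_inr_apply]

/-! ### Smoothness -/

/-- **`(μ, θ) ↦ u_μ(θ)` is `C^n` at every point of `(-4, 0) × ℝ`** (every `n ≤ ω`): the implicit
function theorem for `G((μ,θ),t) = F(θ,t) - μ` at the Fermi point, plus local uniqueness against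
the jointly continuous solution `u`. [folklore] -/
theorem contDiffAt_bandFermiRadius_uncurry {μ θ : ℝ} (hμ₁ : -4 < μ) (hμ₂ : μ < 0)
    {n : WithTop ℕ∞} : ContDiffAt ℝ n (fun p : ℝ × ℝ => bandFermiRadius p.1 p.2) (μ, θ) := by
  suffices h : ContDiffAt ℝ ω (fun p : ℝ × ℝ => bandFermiRadius p.1 p.2) (μ, θ) from h.of_le le_top
  set G : (ℝ × ℝ) × ℝ → ℝ := fun x => rayDispersion (x.1.2, x.2) - x.1.1 with hG
  have cdf : ContDiffAt ℝ ω G ((μ, θ), bandFermiRadius μ θ) := contDiff_bandLevelFun.contDiffAt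
  have pn : (ω : WithTop ℕ∞) ≠ 0 := by simp
  have if₂ := isInvertible_fderiv_bandLevelFun_comp_inr (μ := μ)
    (rayDispersionDt_bandFermiRadius_pos hμ₁ hμ₂ θ).ne'
  have hψ : ContDiffAt ℝ ω (cdf.implicitFunction pn if₂) (μ, θ) :=
    cdf.contDiffAt_implicitFunction pn if₂
  have hev := cdf.eventually_apply_eq_iff_implicitFunction pn if₂
  -- `u` is jointly continuous at `(μ, θ)`, so `(p, u p) → ((μ, θ), u(μ, θ))`
  have hUopen : IsOpen (Ioo (-4 : ℝ) 0 ×ˢ (univ : Set ℝ)) := isOpen_Ioo.prod isOpen_univ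
  have hmem : ((μ, θ) : ℝ × ℝ) ∈ Ioo (-4 : ℝ) 0 ×ˢ (univ : Set ℝ) := ⟨⟨hμ₁, hμ₂⟩, mem_univ _⟩
  have hcontAt : ContinuousAt (fun p : ℝ × ℝ => bandFermiRadius p.1 p.2) (μ, θ) :=
    continuousOn_bandFermiRadius.continuousAt (hUopen.mem_nhds hmem)
  have hcont : Tendsto (fun p : ℝ × ℝ => ((p, bandFermiRadius p.1 p.2) : (ℝ × ℝ) × ℝ)) (𝓝 (μ, θ))
      (𝓝 ((μ, θ), bandFermiRadius μ θ)) :=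
    continuousAt_id.prodMk hcontAt
  have hU : ∀ᶠ p : ℝ × ℝ in 𝓝 (μ, θ), p.1 ∈ Ioo (-4 : ℝ) 0 :=
    continuous_fst.continuousAt.eventually (isOpen_Ioo.mem_nhds ⟨hμ₁, hμ₂⟩)
  have heq : (fun p : ℝ × ℝ => bandFermiRadius p.1 p.2) =ᶠ[𝓝 (μ, θ)] cdf.implicitFunction pn if₂ := by
    filter_upwards [hcont.eventually hev, hU] with p hp hpU
    have hGp : G (p, bandFermiRadius p.1 p.2) = G ((μ, θ), bandFermiRadius μ θ) := by
      simp only [hG]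
      rw [rayDispersion_bandFermiRadius hpU.1 hpU.2, rayDispersion_bandFermiRadius hμ₁ hμ₂, sub_self,
        sub_self]
    exact (hp.1 hGp).symm
  exact hψ.congr_of_eventuallyEq heq

/-- **`(μ, θ) ↦ u_μ(θ)` is `C^n` on `(-4, 0) × ℝ`.** [folklore] -/
theorem contDiffOn_bandFermiRadius_uncurry {n : WithTop ℕ∞} :
    ContDiffOn ℝ n (fun p : ℝ × ℝ => bandFermiRadius p.1 p.2) (Ioo (-4 : ℝ) 0 ×ˢ univ) :=
  fun _ hp => (contDiffAt_bandFermiRadius_uncurry hp.1.1 hp.1.2).contDiffWithinAt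

/-- **`θ ↦ u_μ(θ)` is `C^n`** for `-4 < μ < 0`. [folklore] -/
theorem contDiff_bandFermiRadius {μ : ℝ} (hμ₁ : -4 < μ) (hμ₂ : μ < 0) {n : WithTop ℕ∞} :
    ContDiff ℝ n (bandFermiRadius μ) := by
  have h : ContDiff ℝ n ((fun p : ℝ × ℝ => bandFermiRadius p.1 p.2) ∘ fun θ : ℝ => ((μ, θ) : ℝ × ℝ)) :=
    contDiff_iff_contDiffAt.2 fun θ =>
      (contDiffAt_bandFermiRadius_uncurry hμ₁ hμ₂).comp θ (contDiff_prodMk_right μ).contDiffAt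
  exact h

/-- `u_μ` is differentiable in the angle. [folklore] -/
theorem differentiable_bandFermiRadius {μ : ℝ} (hμ₁ : -4 < μ) (hμ₂ : μ < 0) :
    Differentiable ℝ (bandFermiRadius μ) :=
  (contDiff_bandFermiRadius hμ₁ hμ₂ (n := 1)).differentiable one_ne_zero

/-! ### The first derivatives in closed form -/

section Deriv

variable {μ : ℝ} (hμ₁ : -4 < μ) (hμ₂ : μ < 0)
include hμ₁ hμ₂

/-- **The angular derivative of the band Fermi radius**: `∂_θ u = -∂_θF(θ,u)/∂_tF(θ,u)`
(differentiate `F(θ, u(θ)) = μ`). [folklore] -/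
theorem hasDerivAt_bandFermiRadius (θ : ℝ) :
    HasDerivAt (bandFermiRadius μ) (bandFermiRadiusDeriv μ θ) θ := by
  have hu : HasDerivAt (bandFermiRadius μ) (deriv (bandFermiRadius μ) θ) θ :=
    (differentiable_bandFermiRadius hμ₁ hμ₂ θ).hasDerivAt
  have hF : HasFDerivAt rayDispersion (fderiv ℝ rayDispersion (θ, bandFermiRadius μ θ))
      (θ, bandFermiRadius μ θ) :=
    ((contDiff_rayDispersion (n := 1)).differentiable one_ne_zero _).hasFDerivAt
  have hg : HasDerivAt (fun ϑ : ℝ => ((ϑ, bandFermiRadius μ ϑ) : ℝ × ℝ))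
      ((1 : ℝ), deriv (bandFermiRadius μ) θ) θ := (hasDerivAt_id θ).prodMk hu
  have hG : HasDerivAt (rayDispersion ∘ fun ϑ : ℝ => ((ϑ, bandFermiRadius μ ϑ) : ℝ × ℝ))
      (fderiv ℝ rayDispersion (θ, bandFermiRadius μ θ) (1, deriv (bandFermiRadius μ) θ)) θ :=
    HasFDerivAt.comp_hasDerivAt (l := rayDispersion)
      (f := fun ϑ : ℝ => ((ϑ, bandFermiRadius μ ϑ) : ℝ × ℝ)) θ hF hg
  have hG0 : HasDerivAt (rayDispersion ∘ fun ϑ : ℝ => ((ϑ, bandFermiRadius μ ϑ) : ℝ × ℝ)) 0 θ := by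
    have : (rayDispersion ∘ fun ϑ : ℝ => ((ϑ, bandFermiRadius μ ϑ) : ℝ × ℝ)) = fun _ => μ :=
      funext fun ϑ => rayDispersion_bandFermiRadius hμ₁ hμ₂ ϑ
    rw [this]
    exact hasDerivAt_const θ μ
  have hrel := hG.unique hG0
  rw [fderiv_rayDispersion_apply, one_mul] at hrel
  have hDt : rayDispersionDt θ (bandFermiRadius μ θ) ≠ 0 :=
    (rayDispersionDt_bandFermiRadius_pos hμ₁ hμ₂ θ).ne'
  have hval : deriv (bandFermiRadius μ) θ = bandFermiRadiusDeriv μ θ := by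
    rw [bandFermiRadiusDeriv, eq_div_iff hDt]
    linarith
  rwa [hval] at hu

/-- `deriv u_μ = bandFermiRadiusDeriv μ`. [folklore] -/
theorem deriv_bandFermiRadius (θ : ℝ) :
    deriv (bandFermiRadius μ) θ = bandFermiRadiusDeriv μ θ :=
  (hasDerivAt_bandFermiRadius hμ₁ hμ₂ θ).deriv

/-- **The level derivative of the band Fermi radius**: `∂_μ u = 1/∂_tF(θ,u)` (differentiate
`F(θ, u_μ(θ)) = μ` in `μ`). [folklore] -/
theorem hasDerivAt_bandFermiRadius_level (θ : ℝ) :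
    HasDerivAt (fun ν : ℝ => bandFermiRadius ν θ) (1 / rayDispersionDt θ (bandFermiRadius μ θ)) μ := by
  -- differentiability in `μ` from joint smoothness
  have hd : DifferentiableAt ℝ (fun ν : ℝ => bandFermiRadius ν θ) μ := by
    have h1 : DifferentiableAt ℝ (fun p : ℝ × ℝ => bandFermiRadius p.1 p.2) (μ, θ) :=
      (contDiffAt_bandFermiRadius_uncurry hμ₁ hμ₂ (n := 1)).differentiableAt one_ne_zero
    exact DifferentiableAt.comp μ (g := fun p : ℝ × ℝ => bandFermiRadius p.1 p.2)
      (f := fun ν : ℝ => ((ν, θ) : ℝ × ℝ)) h1 (differentiableAt_id.prodMk (differentiableAt_const θ))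
  have hu : HasDerivAt (fun ν : ℝ => bandFermiRadius ν θ) (deriv (fun ν : ℝ => bandFermiRadius ν θ) μ) μ :=
    hd.hasDerivAt
  have hF : ∀ ν, HasDerivAt (fun s => rayDispersion (θ, s)) (rayDispersionDt θ (bandFermiRadius ν θ))
      (bandFermiRadius ν θ) := fun ν => hasDerivAt_rayDispersion_radius θ _
  have hG : HasDerivAt (fun ν : ℝ => rayDispersion (θ, bandFermiRadius ν θ))
      (rayDispersionDt θ (bandFermiRadius μ θ) * deriv (fun ν : ℝ => bandFermiRadius ν θ) μ) μ :=
    HasDerivAt.comp μ (h₂ := fun s : ℝ => rayDispersion (θ, s)) (h := fun ν : ℝ => bandFermiRadius ν θ)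
      (hF μ) hu
  -- near `μ` the composite is the identity
  have hU : ∀ᶠ ν : ℝ in 𝓝 μ, ν ∈ Ioo (-4 : ℝ) 0 := isOpen_Ioo.mem_nhds ⟨hμ₁, hμ₂⟩
  have hG1 : HasDerivAt (fun ν : ℝ => rayDispersion (θ, bandFermiRadius ν θ)) 1 μ := by
    refine (hasDerivAt_id μ).congr_of_eventuallyEq ?_
    filter_upwards [hU] with ν hν
    exact rayDispersion_bandFermiRadius hν.1 hν.2 θ
  have hrel := hG.unique hG1
  have hDt : rayDispersionDt θ (bandFermiRadius μ θ) ≠ 0 :=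
    (rayDispersionDt_bandFermiRadius_pos hμ₁ hμ₂ θ).ne'
  have hval : deriv (fun ν : ℝ => bandFermiRadius ν θ) μ = 1 / rayDispersionDt θ (bandFermiRadius μ θ) := by
    rw [eq_div_iff hDt, mul_comm]
    exact hrel
  rwa [hval] at hu

end Deriv

/-! ### Joint continuity of the angular derivative -/

/-- The two partial derivatives of `F` are continuous. [folklore] -/
theorem continuous_rayDispersionDθ : Continuous fun p : ℝ × ℝ => rayDispersionDθ p.1 p.2 := by
  unfold rayDispersionDθ; fun_prop

/-- The two partial derivatives of `F` are continuous. [folklore] -/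
theorem continuous_rayDispersionDt : Continuous fun p : ℝ × ℝ => rayDispersionDt p.1 p.2 := by
  unfold rayDispersionDt; fun_prop

/-- **The angular derivative `∂_θ u_μ(θ)` is jointly continuous in `(μ, θ)` on `(-4, 0) × ℝ`**
(it is the closed form `-∂_θF(θ,u)/∂_tF(θ,u)` with `u` jointly continuous and `∂_tF > 0`).
[folklore] -/
theorem continuousOn_bandFermiRadius_angleDeriv :
    ContinuousOn (fun p : ℝ × ℝ => bandFermiRadiusDeriv p.1 p.2) (Ioo (-4 : ℝ) 0 ×ˢ univ) := by
  unfold bandFermiRadiusDeriv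
  have hu := continuousOn_bandFermiRadius
  have hpair : ContinuousOn (fun p : ℝ × ℝ => ((p.2, bandFermiRadius p.1 p.2) : ℝ × ℝ))
      (Ioo (-4 : ℝ) 0 ×ˢ univ) := continuous_snd.continuousOn.prodMk hu
  -- (elaborate the compositions first, then ascribe the `β`-reduced statements)
  have hnum₀ := continuous_rayDispersionDθ.comp_continuousOn hpair
  have hnum : ContinuousOn (fun p : ℝ × ℝ => rayDispersionDθ p.2 (bandFermiRadius p.1 p.2))
      (Ioo (-4 : ℝ) 0 ×ˢ univ) := hnum₀
  have hden₀ := continuous_rayDispersionDt.comp_continuousOn hpair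
  have hden : ContinuousOn (fun p : ℝ × ℝ => rayDispersionDt p.2 (bandFermiRadius p.1 p.2))
      (Ioo (-4 : ℝ) 0 ×ˢ univ) := hden₀
  have hne : ∀ p ∈ Ioo (-4 : ℝ) 0 ×ˢ (univ : Set ℝ),
      rayDispersionDt p.2 (bandFermiRadius p.1 p.2) ≠ 0 := fun p hp =>
    (rayDispersionDt_bandFermiRadius_pos hp.1.1 hp.1.2 p.2).ne'
  have h := hnum.neg.div hden hne
  exact h

/-- The same at fixed level: `θ ↦ ∂_θ u_μ(θ)` is continuous. [folklore] -/
theorem continuous_bandFermiRadiusDeriv {μ : ℝ} (hμ₁ : -4 < μ) (hμ₂ : μ < 0) :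
    Continuous (bandFermiRadiusDeriv μ) := by
  have h := (contDiff_bandFermiRadius hμ₁ hμ₂ (n := 1)).continuous_deriv le_rfl
  exact h.congr fun θ => deriv_bandFermiRadius hμ₁ hμ₂ θ

end Literature.MathematicalPhysics.QuantumLattice

end
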